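import Literature.Analysis.FluidPDE.OseenHeat
import Literature.Analysis.FluidPDE.WholeSpaceIBP
import HarnessLib

/-!
# The Oseen–heat operator `𝒩_τ = e^{τΔ} P ∇·`: semigroup law, smoothness, heat equation in `τ`

Analysis/FluidPDE support file, first layer of the physical-space (`L^∞`) theory of mild
solutions of the Navier–Stokes equations with bounded data (Leray 1934, Ch. III; Ożański–Pooley
2018, §6.3), which discharges the named fact
`Literature.Analysis.FluidPDE.leray_strong_local_existence` (`NSLerayBlowupRate.lean`). The tree
realises the Duhamel integrand `e^{τΔ} P ∇·F` of a matrix field `F = (Fⱼₖ)` without Fourier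
analysis as `oseenHeat τ F i = ∑ⱼ ∂ⱼ e^{τΔ} Fⱼᵢ + ∑ⱼₖ ∫₀^∞ ∂ᵢ∂ⱼ∂ₖ e^{(τ+σ)Δ} Fⱼₖ dσ`
(`OseenHeat.lean`, with the kernel bounds `|(𝒩_τ F)ᵢ| ≤ 327 τ^{-1/2} ∑‖Fⱼₖ‖_∞` etc.). Here we add,
for **bounded** matrix fields (`Fⱼₖ ∈ L^∞`, the class of `u ⊗ u` for bounded `u`) in dimension
three:

* **semigroup laws** (`section SemigroupA`, `LerayCorrection`, `OseenSemigroup`):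
  `e^{aΔ}(∂ᵥ e^{cΔ} φ) = ∂ᵥ e^{(a+c)Δ} φ`, `e^{aΔ}(∂³ e^{sΔ} φ) = ∂³ e^{(a+s)Δ} φ`,
  `e^{aΔ}(∫₀^∞ ∂³ e^{(c+σ)Δ} φ dσ) = ∫₀^∞ ∂³ e^{(a+c+σ)Δ} φ dσ` (Fubini, the double integrand being
  dominated by `G_a(x - y) · 162 (c+σ)^{-3/2} ‖φ‖_∞`), whence
  `e^{aΔ} (𝒩_c F)ᵢ = (𝒩_{a+c} F)ᵢ` (`heatExtension_oseenHeat`), i.e.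
  `e^{aΔ} e^{cΔ} P∇· = e^{(a+c)Δ} P∇·` on the heat-flow realisation;
* **derivative bounds for the heat flow of bounded data** (`section HeatBounds`):
  `|∂ⱼ e^{aΔ} φ| ≤ 3 a^{-1/2} ‖φ‖_∞`, `|∂ᵢ∂ⱼ e^{tΔ} φ| ≤ 18 t⁻¹ ‖φ‖_∞`,
  `|Δ e^{tΔ} φ| ≤ 54 t⁻¹ ‖φ‖_∞` (two `D¹` layers at the clock `t/2`; `Δ` as the trace of `D²` over
  the frame, `laplacian_eq_sum_fderiv_fderiv`);
* **consequences for `𝒩_τ`** (`section OseenTime`): real form of the `L^∞` bound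
  (`|(𝒩_τ F)ᵢ| ≤ 2943 τ^{-1/2} B` when `‖Fⱼₖ‖_∞ ≤ B`), measurability, `L^∞` membership,
  smoothness in `x` (`contDiff_oseenHeat`: `𝒩_τ F = e^{(τ/2)Δ} 𝒩_{τ/2} F`), the **heat equation in
  the time parameter** `∂_τ (𝒩_τ F)ᵢ = Δ (𝒩_τ F)ᵢ` (`hasDerivAt_oseenHeat_time`), the Laplacian
  bound `|Δ (𝒩_σ F)ᵢ| ≤ 477000 σ^{-3/2} B`, the time FTC
  `(𝒩_{τ'} F)ᵢ - (𝒩_τ F)ᵢ = ∫_τ^{τ'} Δ (𝒩_s F)ᵢ ds` and the resulting **modulus of continuity in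
  `τ`**, `|(𝒩_{τ'} F)ᵢ (x) - (𝒩_τ F)ᵢ (x)| ≤ 954000 B (τ^{-1/2} - τ'^{-1/2})`.

These are the operator-norm facts from which the Duhamel integral
`∫₀ᵗ 𝒩_{ν(t-s)}[u ⊗ u](s) ds` is bounded, continuous in `(t, x)` and restartable
(`OseenDuhamel.lean`, next layer), with no further dominated-convergence arguments: Leray 1934,
§§11–12 (the integrals `(2.13)`–`(2.18)` and their continuity in `t`); Ożański–Pooley 2018,
Lemma 6.9 and (6.13)–(6.15) (the Oseen kernel `𝒯`, `‖∇𝒯(t)‖₁ ≤ C t^{-1/2}`, `‖∇𝒯(t)‖_∞ ≤ C t⁻²`).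
Numerical constants are explicit but not optimised. Everything is proved; no named facts.

## Mathlib / tree search

Tree: `OseenHeat` (`heatD1/2/3`, `oseenHeat`, `heatD2_eq_heatD1_heatD1`,
`heatD3_eq_heatD1_heatD1_heatD1`, `enorm_oseenHeat_le_of_top`, `enorm_heatD3_le_of_top`,
`enorm_integral_Ioi_heatD3_le`, `aestronglyMeasurable_heatD3_param`), `HeatFlowCalculus`
(`fderiv_heatExtension_apply_eq_heatExtension_fderiv`, `heatExtension_sub_eq_integral_laplacian`,
`continuousOn_laplacian_heatExtension_time`, `continuousOn_uncurry_heatExtension_of_memLp`),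
`HeatKernel*` (`heatExtension_add_holds`, `contDiff_heatExtension_holds`,
`hasDerivAt_heatExtension_time`, `convolutionExistsAt_of_memLp`, `heatExtension_finset_sum`),
`WholeSpaceIBP` (`laplacian_eq_sum_fderiv_fderiv`). `lean search 'heatExtension.*oseenHeat|
oseenHeat.*heatExtension|hasDerivAt_oseenHeat'`: nothing before this file. Mathlib:
`ConvolutionExistsAt.distrib_add`, `MeasureTheory.integral_integral_swap`,
`Integrable.mul_prod`, `MeasurePreserving.integrableOn_comp_preimage`, `integral_rpow`,
`intervalIntegral.norm_integral_le_of_norm_le`, `HasDerivAt.comp_sub_const`.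

## References

* J. Leray, *Sur le mouvement d'un liquide visqueux emplissant l'espace*, Acta Math. 63 (1934),
  §8 (the tensor `T_{ij}`), §§11–12 (bounds and continuity of the Oseen integrals), §15 (3.2).
  [Leray1934]
* W. S. Ożański, B. C. Pooley, *Leray's fundamental work on the Navier–Stokes equations: a modern
  review*, LMS Lecture Note Ser. 452 (CUP 2018), §6.1.3 (the Oseen kernel `𝒯`, (6.13)–(6.15)),
  Lemma 6.9. [OzanskiPooley2018]
* P. G. Lemarié-Rieusset, *The Navier–Stokes Problem in the 21st Century*, CRC 2016, §6.2
  (heat kernel and Oseen tensor). [LemarieRieusset2016]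
-/

open MeasureTheory Filter Topology Set InnerProductSpace Metric
open scoped Real ENNReal NNReal Convolution Laplacian RealInnerProductSpace

noncomputable section

namespace Literature.Analysis.FluidPDE

section SemigroupA
variable {E : Type*} [NormedAddCommGroup E] [InnerProductSpace ℝ E] [FiniteDimensional ℝ E]
  [MeasurableSpace E] [BorelSpace E]
variable {φ : E → ℝ} {p : ℝ≥0∞}

/-- **Semigroup law for `D¹`**: `e^{aΔ}(∂ᵥ e^{cΔ} φ) = ∂ᵥ e^{(a+c)Δ} φ` for `φ ∈ Lᵖ`, `a, c > 0`
(heat semigroup law; derivatives fall on smooth `Lᵖ` data). [folklore] -/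
theorem heatExtension_heatD1 (hφ : MemLp φ p volume) (hp : 1 ≤ p) {a c : ℝ} (ha : 0 < a)
    (hc : 0 < c) (v : E) :
    UnboundedOperators.heatExtension (heatD1 c v φ) a = heatD1 (a + c) v φ := by
  funext x
  unfold heatD1
  have hsemi : UnboundedOperators.heatExtension φ (a + c) =
      UnboundedOperators.heatExtension (UnboundedOperators.heatExtension φ c) a := by
    rw [UnboundedOperators.heatExtension_add_holds hφ hp hc ha, add_comm]
  rw [hsemi]
  exact (UnboundedOperators.fderiv_heatExtension_apply_eq_heatExtension_fderiv
    ((UnboundedOperators.contDiff_heatExtension_holds hφ hp hc).of_le (by exact_mod_cast le_top))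
    (UnboundedOperators.memLp_heatExtension_holds hφ hp hc) hp
    (UnboundedOperators.memLp_fderiv_heatExtension_apply hφ hp hc v) hp ha x).symm

/-- **Semigroup law for `D³`**: `e^{aΔ}(∂ᵤ∂ᵥ∂_w e^{sΔ} φ) = ∂ᵤ∂ᵥ∂_w e^{(a+s)Δ} φ` for `φ ∈ Lᵖ`,
`a, s > 0` (three `D¹` layers at the clock `s/3`). [folklore] -/
theorem heatExtension_heatD3 (hφ : MemLp φ p volume) (hp : 1 ≤ p) {a s : ℝ} (ha : 0 < a)
    (hs : 0 < s) (u v w : E) :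
    UnboundedOperators.heatExtension (heatD3 s u v w φ) a = heatD3 (a + s) u v w φ := by
  have h3 : 0 < s / 3 := by positivity
  have hsplit : s = s / 3 + s / 3 + s / 3 := by ring
  have hψ₂ : MemLp (heatD1 (s / 3) v (heatD1 (s / 3) w φ)) p volume :=
    memLp_heatD1 (memLp_heatD1 hφ hp h3 w) hp h3 v
  conv_lhs => rw [hsplit, heatD3_eq_heatD1_heatD1_heatD1 hφ hp h3 h3 h3 u v w]
  rw [heatExtension_heatD1 hψ₂ hp ha h3 u]
  have hsplit' : a + s = (a + s / 3) + s / 3 + s / 3 := by ring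
  rw [hsplit', heatD3_eq_heatD1_heatD1_heatD1 hφ hp (by positivity) h3 h3 u v w]
end SemigroupA

section LerayCorrection

variable {E : Type*} [NormedAddCommGroup E] [InnerProductSpace ℝ E] [FiniteDimensional ℝ E]
  [MeasurableSpace E] [BorelSpace E]

/-- Integrability of `σ ↦ C (c + σ)^{-e}` on `(0, ∞)` for `c > 0`, `e > 1`. [folklore] -/
theorem integrableOn_const_mul_rpow_const_add {c e : ℝ} (hc : 0 < c) (he : 1 < e) (C : ℝ) :
    IntegrableOn (fun σ : ℝ => C * (c + σ) ^ (-e)) (Ioi 0) := by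
  have h : IntegrableOn (fun s : ℝ => C * s ^ (-e)) (Ioi c) :=
    (integrableOn_Ioi_rpow_of_lt (by linarith : -e < -1) hc).const_mul C
  have h2 := ((measurePreserving_add_left volume c).integrableOn_comp_preimage
    (measurableEmbedding_addLeft c)).2 h
  rw [preimage_const_add_Ioi, sub_self] at h2
  exact h2

variable {φ : E → ℝ} {p : ℝ≥0∞}

/-- Continuity in the correction time: `σ ↦ ∂³ e^{(c+σ)Δ} φ (x)` is continuous on `(0, ∞)` for
`φ ∈ Lᵖ`, `c > 0` (it is `σ ↦ e^{σΔ}(∂³ e^{cΔ} φ)(x)`). [folklore] -/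
theorem continuousOn_heatD3_const_add (hφ : MemLp φ p volume) (hp : 1 ≤ p) {c : ℝ} (hc : 0 < c)
    (u v w : E) (x : E) :
    ContinuousOn (fun σ : ℝ => heatD3 (c + σ) u v w φ x) (Ioi 0) := by
  have hg : MemLp (heatD3 c u v w φ) p volume := memLp_heatD3 hφ hp hc u v w
  refine (UnboundedOperators.continuousOn_heatExtension_time hg hp x).congr fun σ hσ => ?_
  have hσ' : (0 : ℝ) < σ := hσ
  show heatD3 (c + σ) u v w φ x = UnboundedOperators.heatExtension (heatD3 c u v w φ) σ x
  rw [heatExtension_heatD3 hφ hp hσ' hc, add_comm σ c]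

/-- Joint continuity `(σ, x) ↦ ∂³ e^{(c+σ)Δ} φ (x)` on `(0, ∞) × E` for `φ ∈ Lᵖ`, `c > 0`.
[folklore] -/
theorem continuousOn_uncurry_heatD3_const_add (hφ : MemLp φ p volume) (hp : 1 ≤ p) {c : ℝ}
    (hc : 0 < c) (u v w : E) :
    ContinuousOn (fun q : ℝ × E => heatD3 (c + q.1) u v w φ q.2) (Ioi 0 ×ˢ univ) := by
  have hg : MemLp (heatD3 c u v w φ) p volume := memLp_heatD3 hφ hp hc u v w
  refine (UnboundedOperators.continuousOn_uncurry_heatExtension_of_memLp hg hp).congr fun q hq => ?_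
  have hσ' : (0 : ℝ) < q.1 := hq.1
  show heatD3 (c + q.1) u v w φ q.2 = UnboundedOperators.heatExtension (heatD3 c u v w φ) q.1 q.2
  rw [heatExtension_heatD3 hφ hp hσ' hc, add_comm q.1 c]

/-- Joint measurability of `(σ, y) ↦ ∂³ e^{(c+σ)Δ} φ (y)` on `(0, ∞) × E` for `φ ∈ Lᵖ`.
[folklore] -/
theorem aestronglyMeasurable_heatD3_const_add (hφ : MemLp φ p volume) (hp : 1 ≤ p) {c : ℝ}
    (hc : 0 < c) (u v w : E) :
    AEStronglyMeasurable (fun q : ℝ × E => heatD3 (c + q.1) u v w φ q.2)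
      ((volume.restrict (Ioi (0 : ℝ))).prod (volume : Measure E)) := by
  have hmeas : MeasurableSet (Ioi (0 : ℝ) ×ˢ (univ : Set E)) := measurableSet_Ioi.prod MeasurableSet.univ
  have h := (continuousOn_uncurry_heatD3_const_add hφ hp hc u v w).aestronglyMeasurable
    (μ := (volume : Measure ℝ).prod (volume : Measure E)) hmeas
  rw [← Measure.prod_restrict, Measure.restrict_univ] at h
  exact h

/-- The Leray correction of an `L^∞` function is a.e. strongly measurable. [folklore] -/
theorem aestronglyMeasurable_integral_Ioi_heatD3 (hφ : MemLp φ p volume) (hp : 1 ≤ p) {c : ℝ}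
    (hc : 0 < c) (u v w : E) :
    AEStronglyMeasurable (fun y => ∫ σ in Ioi (0:ℝ), heatD3 (c + σ) u v w φ y) volume :=
  (aestronglyMeasurable_heatD3_const_add hφ hp hc u v w).prod_swap.integral_prod_right'

variable (hE : Module.finrank ℝ E = 3)
include hE

/-- Real-valued form of the `D³` decay for bounded data at the frame vectors:
`|∂³ e^{sΔ} φ (x)| ≤ 162 s^{-3/2} ‖φ‖_∞`. [folklore] -/
theorem norm_heatD3_le_of_top (hφ : MemLp φ ∞ volume) {s : ℝ} (hs : 0 < s)
    (i j k : Fin (Module.finrank ℝ E)) (x : E) :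
    ‖heatD3 s (stdOrthonormalBasis ℝ E i) (stdOrthonormalBasis ℝ E j)
        (stdOrthonormalBasis ℝ E k) φ x‖ ≤
      162 * s ^ (-(3 / 2 : ℝ)) * (eLpNorm φ ∞ volume).toReal := by
  have h := enorm_heatD3_le_of_top hE hφ hs i j k x
  have hfin : eLpNorm φ ∞ volume ≠ ∞ := hφ.eLpNorm_ne_top
  have hnn : 0 ≤ 162 * s ^ (-(3 / 2 : ℝ)) := by positivity
  rw [← ofReal_norm, ← ENNReal.ofReal_toReal hfin, ← ENNReal.ofReal_mul hnn] at h
  exact (ENNReal.ofReal_le_ofReal_iff (by positivity)).1 h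

/-- The Leray-correction integrand `σ ↦ ∂³ e^{(c+σ)Δ} φ (x)` is integrable on `(0, ∞)` for
bounded `φ` and `c > 0` (continuous and `O((c+σ)^{-3/2})`). [folklore] -/
theorem integrableOn_heatD3_const_add_of_top (hφ : MemLp φ ∞ volume) {c : ℝ} (hc : 0 < c)
    (i j k : Fin (Module.finrank ℝ E)) (x : E) :
    IntegrableOn (fun σ : ℝ => heatD3 (c + σ) (stdOrthonormalBasis ℝ E i)
      (stdOrthonormalBasis ℝ E j) (stdOrthonormalBasis ℝ E k) φ x) (Ioi 0) := by
  set b := stdOrthonormalBasis ℝ E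
  have hm : AEStronglyMeasurable (fun σ : ℝ => heatD3 (c + σ) (b i) (b j) (b k) φ x)
      (volume.restrict (Ioi 0)) :=
    (continuousOn_heatD3_const_add hφ le_top hc (b i) (b j) (b k) x).aestronglyMeasurable
      measurableSet_Ioi
  refine Integrable.mono' (integrableOn_const_mul_rpow_const_add hc (by norm_num : (1:ℝ) < 3 / 2)
    (162 * (eLpNorm φ ∞ volume).toReal)) hm ?_
  refine (ae_restrict_iff' measurableSet_Ioi).2 (Eventually.of_forall fun σ hσ => ?_)
  have hσ' : 0 < c + σ := by have : (0:ℝ) < σ := hσ; linarith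
  calc ‖heatD3 (c + σ) (b i) (b j) (b k) φ x‖
      ≤ 162 * (c + σ) ^ (-(3 / 2 : ℝ)) * (eLpNorm φ ∞ volume).toReal :=
        norm_heatD3_le_of_top hE hφ hσ' i j k x
    _ = 162 * (eLpNorm φ ∞ volume).toReal * (c + σ) ^ (-(3 / 2 : ℝ)) := by ring

/-- The **Leray correction** `x ↦ ∫₀^∞ ∂³ e^{(c+σ)Δ} φ (x) dσ` of a bounded `φ` is bounded by
`324 c^{-1/2} ‖φ‖_∞` (real form of the tree's tail bound). [folklore] -/
theorem norm_integral_Ioi_heatD3_le_of_top (hφ : MemLp φ ∞ volume) {c : ℝ} (hc : 0 < c)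
    (i j k : Fin (Module.finrank ℝ E)) (x : E) :
    ‖∫ σ in Ioi (0:ℝ), heatD3 (c + σ) (stdOrthonormalBasis ℝ E i) (stdOrthonormalBasis ℝ E j)
        (stdOrthonormalBasis ℝ E k) φ x‖ ≤ 324 * c ^ (-(1 / 2 : ℝ)) * (eLpNorm φ ∞ volume).toReal := by
  have h := enorm_integral_Ioi_heatD3_le (by norm_num : (0:ℝ) ≤ 162) (by norm_num : (1:ℝ) < 3 / 2)
    (fun s hs => enorm_heatD3_le_of_top hE hφ hs i j k x) hc
  rw [show (1 - 3 / 2 : ℝ) = -(1 / 2) by norm_num, show (3 / 2 - 1 : ℝ) = 1 / 2 by norm_num] at h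
  have heq : (162 : ℝ) * (c ^ (-(1 / 2) : ℝ) / (1 / 2)) = 324 * c ^ (-(1 / 2) : ℝ) := by ring
  rw [heq] at h
  have hfin : eLpNorm φ ∞ volume ≠ ∞ := hφ.eLpNorm_ne_top
  have hnn : 0 ≤ 324 * c ^ (-(1 / 2) : ℝ) := by positivity
  rw [← ofReal_norm, ← ENNReal.ofReal_toReal hfin, ← ENNReal.ofReal_mul hnn] at h
  exact (ENNReal.ofReal_le_ofReal_iff (by positivity)).1 h

/-- The Leray correction of a bounded function is bounded (in `L^∞`). [folklore] -/
theorem memLp_top_integral_Ioi_heatD3 (hφ : MemLp φ ∞ volume) {c : ℝ} (hc : 0 < c)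
    (i j k : Fin (Module.finrank ℝ E)) :
    MemLp (fun y => ∫ σ in Ioi (0:ℝ), heatD3 (c + σ) (stdOrthonormalBasis ℝ E i)
      (stdOrthonormalBasis ℝ E j) (stdOrthonormalBasis ℝ E k) φ y) ∞ volume :=
  memLp_top_of_bound (aestronglyMeasurable_integral_Ioi_heatD3 hφ le_top hc _ _ _) _
    (Eventually.of_forall fun y => norm_integral_Ioi_heatD3_le_of_top hE hφ hc i j k y)

/-- **Semigroup law for the Leray correction**:
`e^{aΔ}(∫₀^∞ ∂³ e^{(c+σ)Δ} φ dσ)(x) = ∫₀^∞ ∂³ e^{(a+c+σ)Δ} φ (x) dσ` for bounded `φ` (Fubini: the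
double integrand is dominated by `G_a(x - y) · 162 (c+σ)^{-3/2} ‖φ‖_∞`). [folklore] -/
theorem heatExtension_integral_Ioi_heatD3 (hφ : MemLp φ ∞ volume) {a c : ℝ} (ha : 0 < a)
    (hc : 0 < c) (i j k : Fin (Module.finrank ℝ E)) (x : E) :
    UnboundedOperators.heatExtension (fun y => ∫ σ in Ioi (0:ℝ), heatD3 (c + σ)
        (stdOrthonormalBasis ℝ E i) (stdOrthonormalBasis ℝ E j) (stdOrthonormalBasis ℝ E k) φ y) a x =
      ∫ σ in Ioi (0:ℝ), heatD3 (a + c + σ) (stdOrthonormalBasis ℝ E i) (stdOrthonormalBasis ℝ E j)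
        (stdOrthonormalBasis ℝ E k) φ x := by
  set b := stdOrthonormalBasis ℝ E
  set H : ℝ → E → ℝ := fun σ y => heatD3 (c + σ) (b i) (b j) (b k) φ y with hH
  rw [UnboundedOperators.heatExtension_eq_integral_sub]
  simp only [smul_eq_mul]
  -- the double integrand `(y, σ) ↦ G_a(x - y) * H σ y` is integrable
  have hK : Integrable (fun y => UnboundedOperators.heatKernel a (x - y)) (volume : Measure E) :=
    (UnboundedOperators.integrable_heatKernel_holds ha).comp_sub_left x
  have hdom : Integrable (fun z : E × ℝ => UnboundedOperators.heatKernel a (x - z.1) *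
      (162 * (eLpNorm φ ∞ volume).toReal * (c + z.2) ^ (-(3 / 2 : ℝ))))
      ((volume : Measure E).prod (volume.restrict (Ioi (0:ℝ)))) :=
    hK.mul_prod (integrableOn_const_mul_rpow_const_add hc (by norm_num : (1:ℝ) < 3 / 2) _)
  have hmeasH : AEStronglyMeasurable (fun z : E × ℝ => H z.2 z.1)
      ((volume : Measure E).prod (volume.restrict (Ioi (0:ℝ)))) :=
    (aestronglyMeasurable_heatD3_const_add hφ le_top hc (b i) (b j) (b k)).prod_swap
  have hmeasK : AEStronglyMeasurable (fun z : E × ℝ => UnboundedOperators.heatKernel a (x - z.1))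
      ((volume : Measure E).prod (volume.restrict (Ioi (0:ℝ)))) :=
    ((UnboundedOperators.continuous_heatKernel a).comp (continuous_const.sub continuous_fst)).aestronglyMeasurable
  have hint : Integrable (Function.uncurry fun (y : E) (σ : ℝ) =>
      UnboundedOperators.heatKernel a (x - y) * H σ y)
      ((volume : Measure E).prod (volume.restrict (Ioi (0:ℝ)))) := by
    refine hdom.mono' (hmeasK.mul hmeasH) ?_
    have hae : ∀ᵐ z : E × ℝ ∂((volume : Measure E).prod (volume.restrict (Ioi (0:ℝ)))), 0 < z.2 :=
      Measure.quasiMeasurePreserving_snd.ae (ae_restrict_mem measurableSet_Ioi)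
    filter_upwards [hae] with z hz
    change ‖UnboundedOperators.heatKernel a (x - z.1) * H z.2 z.1‖ ≤ _
    rw [norm_mul, Real.norm_of_nonneg (UnboundedOperators.heatKernel_pos ha _).le]
    refine mul_le_mul_of_nonneg_left ?_ (UnboundedOperators.heatKernel_pos ha _).le
    have hz' : (0 : ℝ) < z.2 := hz
    have hσ' : 0 < c + z.2 := by linarith
    calc ‖H z.2 z.1‖ ≤ 162 * (c + z.2) ^ (-(3 / 2 : ℝ)) * (eLpNorm φ ∞ volume).toReal :=
          norm_heatD3_le_of_top hE hφ hσ' i j k z.1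
      _ = _ := by ring
  -- Fubini
  have hswap := integral_integral_swap hint
  calc ∫ y, UnboundedOperators.heatKernel a (x - y) * ∫ σ in Ioi (0:ℝ), H σ y
      = ∫ y, ∫ σ in Ioi (0:ℝ), UnboundedOperators.heatKernel a (x - y) * H σ y := by
        simp_rw [← integral_const_mul]
    _ = ∫ σ in Ioi (0:ℝ), ∫ y, UnboundedOperators.heatKernel a (x - y) * H σ y := hswap
    _ = ∫ σ in Ioi (0:ℝ), heatD3 (a + c + σ) (b i) (b j) (b k) φ x := by
        refine setIntegral_congr_fun measurableSet_Ioi fun σ hσ => ?_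
        have hσ' : (0 : ℝ) < σ := hσ
        have hcσ : 0 < c + σ := by linarith
        have h1 : ∫ y, UnboundedOperators.heatKernel a (x - y) * H σ y =
            UnboundedOperators.heatExtension (H σ) a x := by
          rw [UnboundedOperators.heatExtension_eq_integral_sub]
          simp only [smul_eq_mul]
        rw [h1, hH]
        dsimp only
        rw [heatExtension_heatD3 hφ le_top ha hcσ, add_assoc]

end LerayCorrection

section OseenSemigroup

variable {E : Type*} [NormedAddCommGroup E] [InnerProductSpace ℝ E] [FiniteDimensional ℝ E]
  [MeasurableSpace E] [BorelSpace E]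

/-- The caloric extension of an `L^∞` function exists at every point (the heat kernel is in `L¹`).
[folklore] -/
theorem convolutionExistsAt_heatKernel_of_top {f : E → ℝ} (hf : MemLp f ∞ volume) {t : ℝ}
    (ht : 0 < t) (x : E) :
    ConvolutionExistsAt (UnboundedOperators.heatKernel t) f x (ContinuousLinearMap.lsmul ℝ ℝ) volume :=
  UnboundedOperators.convolutionExistsAt_of_memLp (ContinuousLinearMap.lsmul ℝ ℝ)
    ((UnboundedOperators.memLp_heatKernel ht le_rfl)) hf x

/-- Additivity of the caloric extension on `L^∞` data. [folklore] -/
theorem heatExtension_add_of_top {f g : E → ℝ} (hf : MemLp f ∞ volume) (hg : MemLp g ∞ volume)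
    {t : ℝ} (ht : 0 < t) (x : E) :
    UnboundedOperators.heatExtension (f + g) t x =
      UnboundedOperators.heatExtension f t x + UnboundedOperators.heatExtension g t x :=
  (convolutionExistsAt_heatKernel_of_top hf ht x).distrib_add (convolutionExistsAt_heatKernel_of_top hg ht x)

/-- Finite additivity of the caloric extension on `L^∞` data. [folklore] -/
theorem heatExtension_finset_sum_of_top {ι : Type*} (s : Finset ι) {g : ι → E → ℝ}
    (hg : ∀ i ∈ s, MemLp (g i) ∞ volume) {t : ℝ} (ht : 0 < t) (x : E) :
    UnboundedOperators.heatExtension (fun z => ∑ i ∈ s, g i z) t x =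
      ∑ i ∈ s, UnboundedOperators.heatExtension (g i) t x :=
  UnboundedOperators.heatExtension_finset_sum s t x fun i hi =>
    convolutionExistsAt_heatKernel_of_top (hg i hi) ht x

variable (hE : Module.finrank ℝ E = 3)
include hE

/-- **Semigroup law for the Oseen–heat operator**: `e^{aΔ} (𝒩_c F)ᵢ = (𝒩_{a+c} F)ᵢ` for a
bounded matrix field `F` and `a, c > 0` — i.e. `e^{aΔ} e^{cΔ} P∇· = e^{(a+c)Δ} P∇·`, proved on the
heat-flow realisation of `𝒩` (semigroup laws for `∂e^{cΔ}` and for the Leray correction).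
[folklore] -/
theorem heatExtension_oseenHeat {F : Fin (Module.finrank ℝ E) → Fin (Module.finrank ℝ E) → E → ℝ}
    (hF : ∀ j k, MemLp (F j k) ∞ volume) {a c : ℝ} (ha : 0 < a) (hc : 0 < c)
    (i : Fin (Module.finrank ℝ E)) (x : E) :
    UnboundedOperators.heatExtension (oseenHeat c F i) a x = oseenHeat (a + c) F i x := by
  set b := stdOrthonormalBasis ℝ E
  set f₁ : E → ℝ := fun y => ∑ j, heatD1 c (b j) (F j i) y with hf₁
  set f₂ : E → ℝ := fun y => ∑ j, ∑ k, ∫ σ in Ioi (0:ℝ), heatD3 (c + σ) (b i) (b j) (b k) (F j k) y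
    with hf₂
  have hD1 : ∀ j, MemLp (heatD1 c (b j) (F j i)) ∞ volume := fun j =>
    memLp_heatD1 (hF j i) le_top hc (b j)
  have hD3 : ∀ j k, MemLp (fun y => ∫ σ in Ioi (0:ℝ), heatD3 (c + σ) (b i) (b j) (b k) (F j k) y)
      ∞ volume := fun j k => memLp_top_integral_Ioi_heatD3 hE (hF j k) hc i j k
  have hf₁m : MemLp f₁ ∞ volume := memLp_finsetSum _ fun j _ => hD1 j
  have hD3' : ∀ j, MemLp (fun y => ∑ k, ∫ σ in Ioi (0:ℝ), heatD3 (c + σ) (b i) (b j) (b k) (F j k) y)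
      ∞ volume := fun j => memLp_finsetSum _ fun k _ => hD3 j k
  have hf₂m : MemLp f₂ ∞ volume := memLp_finsetSum _ fun j _ => hD3' j
  have hsplit : oseenHeat c F i = f₁ + f₂ := by
    funext y
    rfl
  rw [hsplit, heatExtension_add_of_top hf₁m hf₂m ha x]
  have h1 : UnboundedOperators.heatExtension f₁ a x = ∑ j, heatD1 (a + c) (b j) (F j i) x := by
    rw [hf₁, heatExtension_finset_sum_of_top _ (fun j _ => hD1 j) ha x]
    refine Finset.sum_congr rfl fun j _ => ?_
    rw [heatExtension_heatD1 (hF j i) le_top ha hc (b j)]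
  have h2 : UnboundedOperators.heatExtension f₂ a x =
      ∑ j, ∑ k, ∫ σ in Ioi (0:ℝ), heatD3 (a + c + σ) (b i) (b j) (b k) (F j k) x := by
    rw [hf₂, heatExtension_finset_sum_of_top _ (fun j _ => hD3' j) ha x]
    refine Finset.sum_congr rfl fun j _ => ?_
    rw [heatExtension_finset_sum_of_top _ (fun k _ => hD3 j k) ha x]
    refine Finset.sum_congr rfl fun k _ => ?_
    exact heatExtension_integral_Ioi_heatD3 hE (hF j k) ha hc i j k x
  rw [h1, h2]
  rfl

end OseenSemigroup

section HeatBounds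

variable {E : Type*} [NormedAddCommGroup E] [InnerProductSpace ℝ E] [FiniteDimensional ℝ E]
  [MeasurableSpace E] [BorelSpace E]

variable {φ : E → ℝ} {p : ℝ≥0∞}

/-- The Laplacian of the caloric extension as the trace of `D²` over the frame:
`Δ e^{tΔ} φ (x) = ∑ᵢ ∂ᵢ∂ᵢ e^{tΔ} φ (x)`. [folklore] -/
theorem laplacian_heatExtension_eq_sum_heatD2 (hφ : MemLp φ p volume) (hp : 1 ≤ p) {t : ℝ}
    (ht : 0 < t) (x : E) :
    (Δ (UnboundedOperators.heatExtension φ t)) x =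
      ∑ i, heatD2 t (stdOrthonormalBasis ℝ E i) (stdOrthonormalBasis ℝ E i) φ x := by
  have h2 : ContDiff ℝ 2 (UnboundedOperators.heatExtension φ t) :=
    contDiff_infty.1 (UnboundedOperators.contDiff_heatExtension_holds hφ hp ht) 2
  rw [laplacian_eq_sum_fderiv_fderiv (stdOrthonormalBasis ℝ E) h2 x]
  rfl

/-- Real form of the `L^∞ → L^∞` bound for `D¹`: `|∂ᵥ e^{aΔ} φ (x)| ≤ 2^{n/2} a^{-1/2} ‖v‖ ‖φ‖_∞`.
[folklore] -/
theorem norm_heatD1_le_of_top (hφ : MemLp φ ∞ volume) {a : ℝ} (ha : 0 < a) (v x : E) :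
    ‖heatD1 a v φ x‖ ≤ (2 : ℝ) ^ ((Module.finrank ℝ E : ℝ) / 2) * a ^ (-(1 / 2) : ℝ) * ‖v‖ *
      (eLpNorm φ ∞ volume).toReal := by
  have h1 := enorm_heatD1_le hφ le_top ha v x 1
  rw [eLpNorm_one_eq_lintegral_enorm] at h1
  have h2 := UnboundedOperators.lintegral_enorm_fderiv_heatKernel_apply_le ha v (E := E)
  have hfin : eLpNorm φ ∞ volume ≠ ∞ := hφ.eLpNorm_ne_top
  set c₀ : ℝ := (2 : ℝ) ^ ((Module.finrank ℝ E : ℝ) / 2) * a ^ (-(1 / 2) : ℝ) * ‖v‖ with hc₀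
  have hc₀0 : 0 ≤ c₀ := by rw [hc₀]; positivity
  have h4 : ‖heatD1 a v φ x‖ₑ ≤ ENNReal.ofReal c₀ * eLpNorm φ ∞ volume :=
    h1.trans (mul_le_mul_left h2 _)
  calc ‖heatD1 a v φ x‖ = ‖heatD1 a v φ x‖ₑ.toReal := (toReal_enorm _).symm
    _ ≤ (ENNReal.ofReal c₀ * eLpNorm φ ∞ volume).toReal :=
        ENNReal.toReal_mono (ENNReal.mul_ne_top ENNReal.ofReal_ne_top hfin) h4
    _ = c₀ * (eLpNorm φ ∞ volume).toReal := by
        rw [ENNReal.toReal_mul, ENNReal.toReal_ofReal hc₀0]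

/-- `L^∞` bound of `D¹` as a function: `‖∂ᵥ e^{aΔ} φ‖_∞ ≤ 2^{n/2} a^{-1/2} ‖v‖ ‖φ‖_∞`. [folklore] -/
theorem eLpNorm_top_heatD1_le (hφ : MemLp φ ∞ volume) {a : ℝ} (ha : 0 < a) (v : E) :
    eLpNorm (heatD1 a v φ) ∞ volume ≤
      ENNReal.ofReal ((2 : ℝ) ^ ((Module.finrank ℝ E : ℝ) / 2) * a ^ (-(1 / 2) : ℝ) * ‖v‖) *
        eLpNorm φ ∞ volume := by
  unfold heatD1
  rw [UnboundedOperators.fderiv_heatExtension_apply_eq_convolution' hφ le_top ha v]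
  exact (UnboundedOperators.eLpNorm_convolution_le_lintegral_enorm_mul
    (UnboundedOperators.continuous_fderiv_heatKernel_apply a v).aestronglyMeasurable hφ.1 le_top).trans
    (mul_le_mul_left (UnboundedOperators.lintegral_enorm_fderiv_heatKernel_apply_le ha v) _)

variable (hE : Module.finrank ℝ E = 3)
include hE

omit [FiniteDimensional ℝ E] [MeasurableSpace E] [BorelSpace E] in
/-- In dimension three `2^{n/2} ≤ 3`. [folklore] -/
theorem two_rpow_finrank_half_le_three : (2 : ℝ) ^ ((Module.finrank ℝ E : ℝ) / 2) ≤ 3 := by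
  rw [hE, show ((3 : ℕ) : ℝ) / 2 = (3 / 2 : ℝ) by norm_num]
  exact two_rpow_three_halves_le_three

/-- Dimension-three `D¹` bound at the frame vectors: `|∂ⱼ e^{aΔ} φ (x)| ≤ 3 a^{-1/2} ‖φ‖_∞`.
[folklore] -/
theorem norm_heatD1_frame_le_of_top (hφ : MemLp φ ∞ volume) {a : ℝ} (ha : 0 < a)
    (j : Fin (Module.finrank ℝ E)) (x : E) :
    ‖heatD1 a (stdOrthonormalBasis ℝ E j) φ x‖ ≤ 3 * a ^ (-(1 / 2) : ℝ) * (eLpNorm φ ∞ volume).toReal := by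
  have h := norm_heatD1_le_of_top hφ ha (stdOrthonormalBasis ℝ E j) x
  have hj := norm_stdOrthonormalBasis_le_one (E := E) j
  have h3 := two_rpow_finrank_half_le_three hE
  have ha' : 0 ≤ a ^ (-(1 / 2) : ℝ) := Real.rpow_nonneg ha.le _
  have hN : 0 ≤ (eLpNorm φ ∞ volume).toReal := ENNReal.toReal_nonneg
  refine h.trans ?_
  have : (2 : ℝ) ^ ((Module.finrank ℝ E : ℝ) / 2) * a ^ (-(1 / 2) : ℝ) * ‖stdOrthonormalBasis ℝ E j‖ ≤
      3 * a ^ (-(1 / 2) : ℝ) * 1 := by gcongr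
  nlinarith

/-- Dimension-three `D¹` bound at the frame vectors in `L^∞`: `‖∂ⱼ e^{aΔ} φ‖_∞ ≤ 3 a^{-1/2} ‖φ‖_∞`.
[folklore] -/
theorem eLpNorm_top_heatD1_frame_le (hφ : MemLp φ ∞ volume) {a : ℝ} (ha : 0 < a)
    (j : Fin (Module.finrank ℝ E)) :
    eLpNorm (heatD1 a (stdOrthonormalBasis ℝ E j) φ) ∞ volume ≤
      ENNReal.ofReal (3 * a ^ (-(1 / 2) : ℝ)) * eLpNorm φ ∞ volume :=
  eLpNorm_heatD1_le_dim3 hE hφ le_top ha (norm_stdOrthonormalBasis_le_one j)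

/-- Dimension-three `D²` bound at the frame vectors: `|∂ᵢ∂ⱼ e^{tΔ} φ (x)| ≤ 18 t⁻¹ ‖φ‖_∞`
(two `D¹` layers at the clock `t/2`). [folklore] -/
theorem norm_heatD2_frame_le_of_top (hφ : MemLp φ ∞ volume) {t : ℝ} (ht : 0 < t)
    (i j : Fin (Module.finrank ℝ E)) (x : E) :
    ‖heatD2 t (stdOrthonormalBasis ℝ E i) (stdOrthonormalBasis ℝ E j) φ x‖ ≤
      18 * t⁻¹ * (eLpNorm φ ∞ volume).toReal := by
  set b := stdOrthonormalBasis ℝ E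
  have h2 : 0 < t / 2 := by positivity
  have hsplit := heatD2_eq_heatD1_heatD1 hφ le_top h2 h2 (b i) (b j)
  rw [show t / 2 + t / 2 = t by ring] at hsplit
  rw [hsplit]
  set ψ := heatD1 (t / 2) (b j) φ with hψ
  have hψm : MemLp ψ ∞ volume := memLp_heatD1 hφ le_top h2 (b j)
  have hψb : (eLpNorm ψ ∞ volume).toReal ≤ 3 * (t / 2) ^ (-(1 / 2) : ℝ) * (eLpNorm φ ∞ volume).toReal := by
    have h := eLpNorm_top_heatD1_frame_le hE hφ h2 j
    have hfin : eLpNorm φ ∞ volume ≠ ∞ := hφ.eLpNorm_ne_top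
    have := ENNReal.toReal_mono (ENNReal.mul_ne_top ENNReal.ofReal_ne_top hfin) h
    rwa [ENNReal.toReal_mul, ENNReal.toReal_ofReal (by positivity)] at this
  have h1 := norm_heatD1_frame_le_of_top hE hψm h2 i x
  have hr : (t / 2) ^ (-(1 / 2) : ℝ) * (t / 2) ^ (-(1 / 2) : ℝ) = 2 * t⁻¹ := by
    rw [← Real.rpow_add h2]
    norm_num
    rw [Real.rpow_neg_one]
    field_simp
  have ht' : 0 ≤ (t / 2) ^ (-(1 / 2) : ℝ) := Real.rpow_nonneg h2.le _
  have hN : 0 ≤ (eLpNorm φ ∞ volume).toReal := ENNReal.toReal_nonneg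
  calc ‖heatD1 (t / 2) (b i) ψ x‖ ≤ 3 * (t / 2) ^ (-(1 / 2) : ℝ) * (eLpNorm ψ ∞ volume).toReal := h1
    _ ≤ 3 * (t / 2) ^ (-(1 / 2) : ℝ) * (3 * (t / 2) ^ (-(1 / 2) : ℝ) * (eLpNorm φ ∞ volume).toReal) := by
        gcongr
    _ = 9 * ((t / 2) ^ (-(1 / 2) : ℝ) * (t / 2) ^ (-(1 / 2) : ℝ)) * (eLpNorm φ ∞ volume).toReal := by ring
    _ = 18 * t⁻¹ * (eLpNorm φ ∞ volume).toReal := by rw [hr]; ring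

/-- Dimension-three bound for the Laplacian of the caloric extension of bounded data:
`|Δ e^{tΔ} φ (x)| ≤ 54 t⁻¹ ‖φ‖_∞`. [folklore] -/
theorem norm_laplacian_heatExtension_le_of_top (hφ : MemLp φ ∞ volume) {t : ℝ} (ht : 0 < t)
    (x : E) :
    ‖(Δ (UnboundedOperators.heatExtension φ t)) x‖ ≤ 54 * t⁻¹ * (eLpNorm φ ∞ volume).toReal := by
  rw [laplacian_heatExtension_eq_sum_heatD2 hφ le_top ht x]
  refine (norm_sum_le _ _).trans ?_
  calc ∑ i, ‖heatD2 t (stdOrthonormalBasis ℝ E i) (stdOrthonormalBasis ℝ E i) φ x‖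
      ≤ ∑ _i : Fin (Module.finrank ℝ E), 18 * t⁻¹ * (eLpNorm φ ∞ volume).toReal :=
        Finset.sum_le_sum fun i _ => norm_heatD2_frame_le_of_top hE hφ ht i i x
    _ = 54 * t⁻¹ * (eLpNorm φ ∞ volume).toReal := by
        rw [Finset.sum_const, Finset.card_univ, Fintype.card_fin, hE, nsmul_eq_mul]
        push_cast
        ring

end HeatBounds

section OseenTime

variable {E : Type*} [NormedAddCommGroup E] [InnerProductSpace ℝ E] [FiniteDimensional ℝ E]
  [MeasurableSpace E] [BorelSpace E]

variable (hE : Module.finrank ℝ E = 3)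
include hE

variable {F : Fin (Module.finrank ℝ E) → Fin (Module.finrank ℝ E) → E → ℝ}

omit hE in
/-- In dimension three a componentwise `L^∞` bound `‖Fⱼₖ‖_∞ ≤ B` gives `∑ⱼₖ ‖Fⱼₖ‖_∞ ≤ 9B`. [folklore] -/
theorem sum_eLpNorm_le_nine_mul {B : ℝ} (hB : ∀ j k, eLpNorm (F j k) ∞ volume ≤ ENNReal.ofReal B)
    (hE : Module.finrank ℝ E = 3) :
    ∑ j, ∑ k, eLpNorm (F j k) ∞ volume ≤ ENNReal.ofReal (9 * B) := by
  calc ∑ j, ∑ k, eLpNorm (F j k) ∞ volume ≤ ∑ _j : Fin (Module.finrank ℝ E),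
        ∑ _k : Fin (Module.finrank ℝ E), ENNReal.ofReal B :=
        Finset.sum_le_sum fun j _ => Finset.sum_le_sum fun k _ => hB j k
    _ = ENNReal.ofReal (9 * B) := by
        rw [Finset.sum_const, Finset.sum_const, Finset.card_univ, Fintype.card_fin, hE, nsmul_eq_mul,
          nsmul_eq_mul]
        rw [← mul_assoc, show ((3:ℕ):ℝ≥0∞) * (3:ℕ) = ENNReal.ofReal 9 by push_cast; norm_num,
          ← ENNReal.ofReal_mul (by norm_num)]

/-- **Real form of the `L^∞ → L^∞` bound**: if `‖Fⱼₖ‖_∞ ≤ B` componentwise then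
`|(𝒩_τ F)ᵢ (x)| ≤ 2943 τ^{-1/2} B` (`327 · 9`). [folklore] -/
theorem norm_oseenHeat_le_of_top (hF : ∀ j k, MemLp (F j k) ∞ volume) {B : ℝ} (hB0 : 0 ≤ B)
    (hB : ∀ j k, eLpNorm (F j k) ∞ volume ≤ ENNReal.ofReal B) {τ : ℝ} (hτ : 0 < τ)
    (i : Fin (Module.finrank ℝ E)) (x : E) :
    ‖oseenHeat τ F i x‖ ≤ 2943 * τ ^ (-(1 / 2 : ℝ)) * B := by
  have h := (enorm_oseenHeat_le_of_top hE hF hτ i x).trans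
    (mul_le_mul_right (sum_eLpNorm_le_nine_mul hB hE) _)
  rw [← ofReal_norm, ← ENNReal.ofReal_mul (by positivity)] at h
  have h' := (ENNReal.ofReal_le_ofReal_iff (by positivity)).1 h
  nlinarith [h', Real.rpow_nonneg hτ.le (-(1 / 2 : ℝ))]

/-- `(𝒩_τ F)ᵢ` is a.e. strongly measurable (a finite sum of smooth terms and Leray corrections).
[folklore] -/
theorem aestronglyMeasurable_oseenHeat (hF : ∀ j k, MemLp (F j k) ∞ volume) {τ : ℝ} (hτ : 0 < τ)
    (i : Fin (Module.finrank ℝ E)) : AEStronglyMeasurable (oseenHeat τ F i) volume := by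
  set b := stdOrthonormalBasis ℝ E
  have h1 : ∀ j, AEStronglyMeasurable (heatD1 τ (b j) (F j i)) volume := fun j =>
    (contDiff_heatD1 (hF j i) le_top hτ (b j) (n := 0)).continuous.aestronglyMeasurable
  have h3 : ∀ j k, AEStronglyMeasurable (fun y => ∫ σ in Ioi (0:ℝ), heatD3 (τ + σ) (b i) (b j) (b k)
      (F j k) y) volume := fun j k => (memLp_top_integral_Ioi_heatD3 hE (hF j k) hτ i j k).1
  have : oseenHeat τ F i = fun y => (∑ j, heatD1 τ (b j) (F j i) y) +
      ∑ j, ∑ k, ∫ σ in Ioi (0:ℝ), heatD3 (τ + σ) (b i) (b j) (b k) (F j k) y := by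
    funext y; rfl
  rw [this]
  refine AEStronglyMeasurable.add (Finset.aestronglyMeasurable_fun_sum _ fun j _ => h1 j)
    (Finset.aestronglyMeasurable_fun_sum _ fun j _ =>
      Finset.aestronglyMeasurable_fun_sum _ fun k _ => h3 j k)

omit hE in
/-- A componentwise `L^∞` bound for a bounded matrix field (`B = ∑ⱼₖ ‖Fⱼₖ‖_∞`). [folklore] -/
theorem exists_componentwise_bound (hF : ∀ j k, MemLp (F j k) ∞ volume) :
    ∃ B : ℝ, 0 ≤ B ∧ ∀ j k, eLpNorm (F j k) ∞ volume ≤ ENNReal.ofReal B := by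
  refine ⟨∑ j, ∑ k, (eLpNorm (F j k) ∞ volume).toReal,
    Finset.sum_nonneg fun _ _ => Finset.sum_nonneg fun _ _ => ENNReal.toReal_nonneg, fun j k => ?_⟩
  rw [← ENNReal.ofReal_toReal (hF j k).eLpNorm_ne_top]
  refine ENNReal.ofReal_le_ofReal ?_
  refine (Finset.single_le_sum (f := fun k => (eLpNorm (F j k) ∞ volume).toReal)
    (fun _ _ => ENNReal.toReal_nonneg) (Finset.mem_univ k)).trans ?_
  exact Finset.single_le_sum (f := fun j => ∑ k, (eLpNorm (F j k) ∞ volume).toReal)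
    (fun _ _ => Finset.sum_nonneg fun _ _ => ENNReal.toReal_nonneg) (Finset.mem_univ j)

/-- `(𝒩_τ F)ᵢ ∈ L^∞` for a bounded matrix field. [folklore] -/
theorem memLp_top_oseenHeat (hF : ∀ j k, MemLp (F j k) ∞ volume) {τ : ℝ} (hτ : 0 < τ)
    (i : Fin (Module.finrank ℝ E)) : MemLp (oseenHeat τ F i) ∞ volume := by
  obtain ⟨B, hB0, hB⟩ := exists_componentwise_bound hF
  exact memLp_top_of_bound (aestronglyMeasurable_oseenHeat hE hF hτ i) _
    (Eventually.of_forall fun x => norm_oseenHeat_le_of_top hE hF hB0 hB hτ i x)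

/-- `L^∞` norm bound: `‖(𝒩_τ F)ᵢ‖_∞ ≤ 2943 τ^{-1/2} B` when `‖Fⱼₖ‖_∞ ≤ B`. [folklore] -/
theorem eLpNorm_oseenHeat_le (hF : ∀ j k, MemLp (F j k) ∞ volume) {B : ℝ} (hB0 : 0 ≤ B)
    (hB : ∀ j k, eLpNorm (F j k) ∞ volume ≤ ENNReal.ofReal B) {τ : ℝ} (hτ : 0 < τ)
    (i : Fin (Module.finrank ℝ E)) :
    eLpNorm (oseenHeat τ F i) ∞ volume ≤ ENNReal.ofReal (2943 * τ ^ (-(1 / 2 : ℝ)) * B) := by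
  rw [eLpNorm_exponent_top]
  exact eLpNormEssSup_le_of_ae_bound (Eventually.of_forall fun x => norm_oseenHeat_le_of_top hE hF hB0 hB hτ i x)

/-- Real `L^∞` norm bound: `‖(𝒩_τ F)ᵢ‖_∞ ≤ 2943 τ^{-1/2} B` when `‖Fⱼₖ‖_∞ ≤ B`. [folklore] -/
theorem toReal_eLpNorm_oseenHeat_le (hF : ∀ j k, MemLp (F j k) ∞ volume) {B : ℝ} (hB0 : 0 ≤ B)
    (hB : ∀ j k, eLpNorm (F j k) ∞ volume ≤ ENNReal.ofReal B) {τ : ℝ} (hτ : 0 < τ)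
    (i : Fin (Module.finrank ℝ E)) :
    (eLpNorm (oseenHeat τ F i) ∞ volume).toReal ≤ 2943 * τ ^ (-(1 / 2 : ℝ)) * B := by
  have := ENNReal.toReal_mono ENNReal.ofReal_ne_top (eLpNorm_oseenHeat_le hE hF hB0 hB hτ i)
  rwa [ENNReal.toReal_ofReal (by positivity)] at this

/-- **Semigroup form** `(𝒩_τ F)ᵢ = e^{(τ - τ₀)Δ} (𝒩_{τ₀} F)ᵢ` for `0 < τ₀ < τ`. [folklore] -/
theorem oseenHeat_eq_heatExtension (hF : ∀ j k, MemLp (F j k) ∞ volume) {τ₀ τ : ℝ} (hτ₀ : 0 < τ₀)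
    (hτ : τ₀ < τ) (i : Fin (Module.finrank ℝ E)) :
    oseenHeat τ F i = UnboundedOperators.heatExtension (oseenHeat τ₀ F i) (τ - τ₀) := by
  funext x
  rw [heatExtension_oseenHeat hE hF (sub_pos.2 hτ) hτ₀ i x, sub_add_cancel]

/-- `(𝒩_τ F)ᵢ` is smooth for a bounded matrix field (`= e^{(τ/2)Δ}` of bounded data). [folklore] -/
theorem contDiff_oseenHeat (hF : ∀ j k, MemLp (F j k) ∞ volume) {τ : ℝ} (hτ : 0 < τ)
    (i : Fin (Module.finrank ℝ E)) {n : ℕ∞} : ContDiff ℝ n (oseenHeat τ F i) := by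
  rw [oseenHeat_eq_heatExtension hE hF (half_pos hτ) (half_lt_self hτ) i]
  exact (UnboundedOperators.contDiff_heatExtension_holds (memLp_top_oseenHeat hE hF (half_pos hτ) i)
    le_top (by linarith [half_pos hτ] : 0 < τ - τ / 2)).of_le (by exact_mod_cast le_top)

/-- **The Oseen–heat operator solves the heat equation in the time parameter**:
`∂_τ (𝒩_τ F)ᵢ (x) = Δ (𝒩_τ F)ᵢ (x)`. [folklore] -/
theorem hasDerivAt_oseenHeat_time (hF : ∀ j k, MemLp (F j k) ∞ volume) {σ : ℝ} (hσ : 0 < σ)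
    (i : Fin (Module.finrank ℝ E)) (x : E) :
    HasDerivAt (fun s => oseenHeat s F i x) ((Δ (oseenHeat σ F i)) x) σ := by
  set τ₀ := σ / 2 with hτ₀
  have hτ₀pos : 0 < τ₀ := half_pos hσ
  set g := oseenHeat τ₀ F i with hg
  have hgm : MemLp g ∞ volume := memLp_top_oseenHeat hE hF hτ₀pos i
  -- `s ↦ e^{(s - τ₀)Δ} g (x)` has derivative `Δ e^{(σ - τ₀)Δ} g (x)` at `σ`
  have h1 : HasDerivAt (fun s => UnboundedOperators.heatExtension g (s - τ₀) x)
      ((Δ (UnboundedOperators.heatExtension g (σ - τ₀))) x) σ := by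
    have h := UnboundedOperators.hasDerivAt_heatExtension_time (by linarith : 0 < σ - τ₀) hgm le_top x
    exact HasDerivAt.comp_sub_const σ τ₀ h
  have heq : ∀ᶠ s in 𝓝 σ, UnboundedOperators.heatExtension g (s - τ₀) x = oseenHeat s F i x := by
    filter_upwards [Ioi_mem_nhds (by linarith : τ₀ < σ)] with s hs
    rw [oseenHeat_eq_heatExtension hE hF hτ₀pos hs i]
  rw [oseenHeat_eq_heatExtension hE hF hτ₀pos (by linarith : τ₀ < σ) i]
  exact h1.congr_of_eventuallyEq (heq.mono fun s hs => hs.symm)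

/-- **Laplacian bound**: `|Δ (𝒩_σ F)ᵢ (x)| ≤ 477000 σ^{-3/2} B` when `‖Fⱼₖ‖_∞ ≤ B`
(from `54 (σ/2)⁻¹ · 2943 (σ/2)^{-1/2}` with `√2 ≤ 3/2`). [folklore] -/
theorem norm_laplacian_oseenHeat_le (hF : ∀ j k, MemLp (F j k) ∞ volume) {B : ℝ} (hB0 : 0 ≤ B)
    (hB : ∀ j k, eLpNorm (F j k) ∞ volume ≤ ENNReal.ofReal B) {σ : ℝ} (hσ : 0 < σ)
    (i : Fin (Module.finrank ℝ E)) (x : E) :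
    ‖(Δ (oseenHeat σ F i)) x‖ ≤ 477000 * σ ^ (-(3 / 2 : ℝ)) * B := by
  have h2 : 0 < σ / 2 := half_pos hσ
  rw [oseenHeat_eq_heatExtension hE hF h2 (half_lt_self hσ) i, show σ - σ / 2 = σ / 2 by ring]
  have hgm : MemLp (oseenHeat (σ / 2) F i) ∞ volume := memLp_top_oseenHeat hE hF h2 i
  refine (norm_laplacian_heatExtension_le_of_top hE hgm h2 x).trans ?_
  have hb := toReal_eLpNorm_oseenHeat_le hE hF hB0 hB h2 i
  have hr1 : (σ / 2)⁻¹ = 2 * σ⁻¹ := by field_simp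
  have hr2 : (σ / 2) ^ (-(1 / 2 : ℝ)) = (2 : ℝ) ^ (1 / 2 : ℝ) * σ ^ (-(1 / 2 : ℝ)) := by
    rw [Real.div_rpow hσ.le (by norm_num), Real.rpow_neg (by norm_num : (0:ℝ) ≤ 2), div_eq_mul_inv,
      inv_inv, mul_comm]
  have hr3 : σ⁻¹ * σ ^ (-(1 / 2 : ℝ)) = σ ^ (-(3 / 2 : ℝ)) := by
    rw [← Real.rpow_neg_one, ← Real.rpow_add hσ]; norm_num
  have hsq : (2 : ℝ) ^ (1 / 2 : ℝ) ≤ 3 / 2 := by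
    have : ((2 : ℝ) ^ (1 / 2 : ℝ)) ^ 2 ≤ (3 / 2) ^ 2 := by
      rw [← Real.rpow_natCast, ← Real.rpow_mul (by norm_num)]; norm_num
    exact (pow_le_pow_iff_left₀ (by positivity) (by norm_num) two_ne_zero).1 this
  have hσ1 : 0 ≤ σ⁻¹ := by positivity
  have hσ2 : 0 ≤ σ ^ (-(1 / 2 : ℝ)) := Real.rpow_nonneg hσ.le _
  calc 54 * (σ / 2)⁻¹ * (eLpNorm (oseenHeat (σ / 2) F i) ∞ volume).toReal
      ≤ 54 * (σ / 2)⁻¹ * (2943 * (σ / 2) ^ (-(1 / 2 : ℝ)) * B) := by gcongr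
    _ = (54 * 2 * 2943) * (2 : ℝ) ^ (1 / 2 : ℝ) * (σ⁻¹ * σ ^ (-(1 / 2 : ℝ))) * B := by
        rw [hr1, hr2]; ring
    _ ≤ (54 * 2 * 2943) * (3 / 2) * (σ⁻¹ * σ ^ (-(1 / 2 : ℝ))) * B := by gcongr
    _ = 476766 * σ ^ (-(3 / 2 : ℝ)) * B := by rw [hr3]; ring
    _ ≤ 477000 * σ ^ (-(3 / 2 : ℝ)) * B :=
        mul_le_mul_of_nonneg_right (mul_le_mul_of_nonneg_right (by norm_num)
          (Real.rpow_nonneg hσ.le _)) hB0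

/-- Continuity of `s ↦ Δ (𝒩_s F)ᵢ (x)` on `(0, ∞)`. [folklore] -/
theorem continuousOn_laplacian_oseenHeat_time (hF : ∀ j k, MemLp (F j k) ∞ volume)
    (i : Fin (Module.finrank ℝ E)) (x : E) :
    ContinuousOn (fun s => (Δ (oseenHeat s F i)) x) (Ioi 0) := by
  intro s₀ hs₀
  have hs₀' : (0 : ℝ) < s₀ := hs₀
  set τ₀ := s₀ / 2 with hτ₀
  have hτ₀pos : 0 < τ₀ := half_pos hs₀'
  have hgm : MemLp (oseenHeat τ₀ F i) ∞ volume := memLp_top_oseenHeat hE hF hτ₀pos i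
  have hc : ContinuousOn (fun s => (Δ (UnboundedOperators.heatExtension (oseenHeat τ₀ F i) (s - τ₀))) x)
      (Ioi τ₀) :=
    (UnboundedOperators.continuousOn_laplacian_heatExtension_time hgm le_top x).comp
      (continuousOn_id.sub continuousOn_const) fun s hs => mem_Ioi.2 (sub_pos.2 hs)
  have heq : ∀ s ∈ Ioi τ₀, (Δ (UnboundedOperators.heatExtension (oseenHeat τ₀ F i) (s - τ₀))) x =
      (Δ (oseenHeat s F i)) x := fun s hs => by
    rw [oseenHeat_eq_heatExtension hE hF hτ₀pos hs i]
  have h1 : ContinuousWithinAt (fun s => (Δ (oseenHeat s F i)) x) (Ioi τ₀) s₀ :=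
    ((hc.congr fun s hs => (heq s hs).symm) s₀ (by show τ₀ < s₀; linarith)).congr
      (fun s hs => rfl) rfl
  have hnhds : Ioi τ₀ ∈ 𝓝[Ioi 0] s₀ :=
    mem_nhdsWithin_of_mem_nhds (Ioi_mem_nhds (by linarith : τ₀ < s₀))
  exact (h1.mono_of_mem_nhdsWithin hnhds)

/-- **Time FTC for the Oseen–heat operator**: `(𝒩_{τ'} F)ᵢ (x) - (𝒩_τ F)ᵢ (x) = ∫_τ^{τ'} Δ (𝒩_s F)ᵢ (x) ds`
for `0 < τ ≤ τ'`. [folklore] -/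
theorem oseenHeat_sub_eq_integral_laplacian (hF : ∀ j k, MemLp (F j k) ∞ volume) {τ τ' : ℝ}
    (hτ : 0 < τ) (hττ' : τ ≤ τ') (i : Fin (Module.finrank ℝ E)) (x : E) :
    oseenHeat τ' F i x - oseenHeat τ F i x = ∫ s in τ..τ', (Δ (oseenHeat s F i)) x := by
  rw [intervalIntegral.integral_eq_sub_of_hasDerivAt]
  · intro s hs
    rw [uIcc_of_le hττ'] at hs
    exact hasDerivAt_oseenHeat_time hE hF (by linarith [hs.1]) i x
  · refine ContinuousOn.intervalIntegrable ?_
    rw [uIcc_of_le hττ']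
    exact (continuousOn_laplacian_oseenHeat_time hE hF i x).mono fun s hs => lt_of_lt_of_le hτ hs.1

/-- **Modulus of continuity in the time parameter**:
`|(𝒩_{τ'} F)ᵢ (x) - (𝒩_τ F)ᵢ (x)| ≤ 954000 B (τ^{-1/2} - τ'^{-1/2})` for `0 < τ ≤ τ'` when
`‖Fⱼₖ‖_∞ ≤ B` (integrate the Laplacian bound `477000 s^{-3/2} B`). [folklore] -/
theorem norm_oseenHeat_sub_le (hF : ∀ j k, MemLp (F j k) ∞ volume) {B : ℝ} (hB0 : 0 ≤ B)
    (hB : ∀ j k, eLpNorm (F j k) ∞ volume ≤ ENNReal.ofReal B) {τ τ' : ℝ} (hτ : 0 < τ)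
    (hττ' : τ ≤ τ') (i : Fin (Module.finrank ℝ E)) (x : E) :
    ‖oseenHeat τ' F i x - oseenHeat τ F i x‖ ≤
      954000 * B * (τ ^ (-(1 / 2 : ℝ)) - τ' ^ (-(1 / 2 : ℝ))) := by
  rw [oseenHeat_sub_eq_integral_laplacian hE hF hτ hττ' i x]
  have hg : IntervalIntegrable (fun s : ℝ => 477000 * s ^ (-(3 / 2 : ℝ)) * B) volume τ τ' := by
    refine (ContinuousOn.intervalIntegrable ?_)
    rw [uIcc_of_le hττ']
    refine ContinuousOn.mul (ContinuousOn.mul continuousOn_const ?_) continuousOn_const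
    exact ContinuousOn.rpow_const continuousOn_id fun s hs => Or.inl (lt_of_lt_of_le hτ hs.1).ne'
  refine (intervalIntegral.norm_integral_le_of_norm_le hττ' (Eventually.of_forall fun s hs =>
    norm_laplacian_oseenHeat_le hE hF hB0 hB (lt_of_lt_of_le hτ hs.1.le) i x) hg).trans ?_
  -- `∫_τ^{τ'} s^{-3/2} ds = 2 (τ^{-1/2} - τ'^{-1/2})`
  have hint : ∫ s in τ..τ', s ^ (-(3 / 2 : ℝ)) = 2 * (τ ^ (-(1 / 2 : ℝ)) - τ' ^ (-(1 / 2 : ℝ))) := by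
    have h0 : (0 : ℝ) ∉ uIcc τ τ' := by
      rw [uIcc_of_le hττ']
      exact fun h => absurd h.1 (not_le.2 hτ)
    rw [integral_rpow (Or.inr ⟨by norm_num, h0⟩)]
    rw [show (-(3 / 2 : ℝ) + 1) = -(1 / 2) by norm_num]
    field_simp
    ring
  rw [intervalIntegral.integral_mul_const, intervalIntegral.integral_const_mul, hint]
  nlinarith [Real.rpow_nonneg hτ.le (-(1 / 2 : ℝ)), hB0]

end OseenTime

end Literature.Analysis.FluidPDE

end
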